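import Summits.CriticalPhenomena.Ising3DConformalLimit.Theorems.HarmonicMomentsIsotropyDilutionTransferNuA
import Literature.Probability.LatticeModels.DirInvCorrLength

/-!
# The scaled two-point measures `ν_β`: tails and uniform exponential moments

Support file for item `DilutionTransfer` (stmt-CriticalPhenomena-6037) of route
`HarmonicMomentsIsotropy` (sub-problem `Ising3DConformalLimit`).

* `G_pos`, `msq_pos`, `xi_pos` — positivity on `(0, β_c)`;
* `lintegral_exp_le_of_tail` — exponential tails give an exponential moment (layer decomposition);
* `nu_apply_toReal`, `nu_tail_eq` — `ν_β(B)` and the tails `ν_β{‖y‖ > A}` as the route's cut-off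
  lattice sums (`A² M₂ < |x|² χ`);
* `nu_exp_moment` — **the one-length window CLW (ii) gives `∫ e^{(c/2)‖y‖} dν_β ≤ K` uniformly in
  `β ∈ [β₀, β_c)`.**
-/

noncomputable section

open MeasureTheory Filter Topology Set
open scoped ENNReal NNReal BigOperators
open Literature.Probability.LatticeModels

namespace Summit.CriticalPhenomena.Ising3DConformalLimit.Theorems.HarmonicMomentsIsotropy

/-! ## Positivity of `G_β`, `M₂`, `ξ₂` on `(0, β_c)` -/

/-- `G_β(x) > 0` for `0 < β < β_c` (`free = plus` below `β_c` and `⟨σ₀σₓ⟩⁺_β > 0`). -/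
theorem G_pos {β : ℝ} (hβ : 0 < β) (hβc : β < criticalBeta 3) (x : Site 3) :
    0 < twoPointFree 3 β x := by
  rw [twoPointFree_eq_twoPointPlus_of_spontaneousMagnetization_eq_zero hβ.le
    (spontaneousMagnetization_eq_zero_of_lt_criticalBeta_holds hβ.le hβc) x]
  exact twoPointPlus_pos hβ x

/-- `M₂(β) > 0` for `0 < β < β_c`. -/
theorem msq_pos {β : ℝ} (hβ : 0 < β) (hβc : β < criticalBeta 3) : 0 < msq β := by
  have hsum : Summable fun x : Site 3 => (∑ i, ((x i : ℤ) : ℝ) ^ 2) * twoPointFree 3 β x := by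
    refine IsingInputs.summable_weight_mul_G' hβ.le hβc (A := 9) (B := 0) (q := 2) fun x => ?_
    rw [abs_of_nonneg (Finset.sum_nonneg fun _ _ => sq_nonneg _), ← norm_siteV_sq, add_zero]
    nlinarith [norm_siteV_le x, norm_nonneg (siteV x), norm_nonneg x]
  set e : Site 3 := Pi.single 0 1 with he
  have hterm : (∑ i, ((e i : ℤ) : ℝ) ^ 2) * twoPointFree 3 β e = twoPointFree 3 β e := by
    have : (∑ i, ((e i : ℤ) : ℝ) ^ 2) = 1 := by
      simp [he, Pi.single_apply]
    rw [this, one_mul]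
  calc 0 < twoPointFree 3 β e := G_pos hβ hβc e
    _ = (∑ i, ((e i : ℤ) : ℝ) ^ 2) * twoPointFree 3 β e := hterm.symm
    _ ≤ msq β := hsum.le_tsum e fun x _ =>
        mul_nonneg (Finset.sum_nonneg fun _ _ => sq_nonneg _) (IsingInputs.G_nonneg hβ.le x)

/-- `ξ₂(β) > 0` for `0 < β < β_c`. -/
theorem xi_pos {β : ℝ} (hβ : 0 < β) (hβc : β < criticalBeta 3) : 0 < xi β :=
  Real.sqrt_pos.2 (div_pos (msq_pos hβ hβc) (chi_pos hβ.le hβc))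

/-! ## Exponential moments from exponential tails -/

/-- **Exponential tails give an exponential moment.** For a measure of total mass `≤ 1` on Euclidean
`ℝ³` with `μ{‖y‖ > A} ≤ D e^{-c₀ A}` for all `A ≥ 0` (`c₀ > 0`, `D ≥ 0`),
`∫⁻ e^{(c₀/2)‖y‖} dμ ≤ K(c₀, D) := e^{c₀/2} (D e^{c₀/2} + 1) / (1 - e^{-c₀/2})`. -/
theorem lintegral_exp_le_of_tail {μ : Measure V} (hμ : μ univ ≤ 1) {c₀ D : ℝ} (hc₀ : 0 < c₀)
    (hD : 0 ≤ D)
    (htail : ∀ A : ℝ, 0 ≤ A → μ {y | A < ‖y‖} ≤ ENNReal.ofReal (D * Real.exp (-(c₀ * A)))) :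
    ∫⁻ y, ENNReal.ofReal (Real.exp (c₀ / 2 * ‖y‖)) ∂μ ≤
      ENNReal.ofReal (Real.exp (c₀ / 2) * (D * Real.exp (c₀ / 2) + 1) / (1 - Real.exp (-(c₀ / 2)))) := by
  set D' : ℝ := D * Real.exp (c₀ / 2) + 1 with hD'
  set r : ℝ := Real.exp (-(c₀ / 2)) with hr
  have hr0 : 0 < r := Real.exp_pos _
  have hr1 : r < 1 := Real.exp_lt_one_iff.2 (by linarith)
  -- the layers `S_k = {k ≤ ‖y‖}` and their masses
  have hSk : ∀ k : ℕ, MeasurableSet {y : V | (k : ℝ) ≤ ‖y‖} := fun k =>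
    (isClosed_le continuous_const continuous_norm).measurableSet
  have hmass : ∀ k : ℕ, μ {y : V | (k : ℝ) ≤ ‖y‖} ≤ ENNReal.ofReal (D' * Real.exp (-(c₀ * k))) := by
    intro k
    rcases Nat.eq_zero_or_pos k with rfl | hk
    · calc μ {y : V | ((0 : ℕ) : ℝ) ≤ ‖y‖} ≤ μ univ := measure_mono (subset_univ _)
        _ ≤ 1 := hμ
        _ ≤ ENNReal.ofReal (D' * Real.exp (-(c₀ * (0 : ℕ)))) := by
            rw [← ENNReal.ofReal_one]
            refine ENNReal.ofReal_le_ofReal ?_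
            simp only [Nat.cast_zero, mul_zero, neg_zero, Real.exp_zero, mul_one, hD']
            nlinarith [Real.exp_pos (c₀ / 2)]
    · have hsub : {y : V | (k : ℝ) ≤ ‖y‖} ⊆ {y : V | (k : ℝ) - 1 / 2 < ‖y‖} := fun y hy => by
        simp only [mem_setOf_eq] at hy ⊢; linarith
      calc μ {y : V | (k : ℝ) ≤ ‖y‖} ≤ μ {y : V | (k : ℝ) - 1 / 2 < ‖y‖} := measure_mono hsub
        _ ≤ ENNReal.ofReal (D * Real.exp (-(c₀ * ((k : ℝ) - 1 / 2)))) :=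
            htail _ (by
              have h1 : (1 : ℝ) ≤ k := by exact_mod_cast hk
              linarith)
        _ ≤ ENNReal.ofReal (D' * Real.exp (-(c₀ * k))) := by
            refine ENNReal.ofReal_le_ofReal ?_
            have he : Real.exp (-(c₀ * ((k : ℝ) - 1 / 2))) = Real.exp (c₀ / 2) * Real.exp (-(c₀ * k)) := by
              rw [← Real.exp_add]; ring_nf
            rw [he, ← mul_assoc, hD']
            nlinarith [Real.exp_pos (-(c₀ * k)), Real.exp_pos (c₀ / 2)]
  -- pointwise layer decomposition of the integrand
  set G : ℕ → V → ℝ≥0∞ := fun k y =>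
    ({y : V | (k : ℝ) ≤ ‖y‖}).indicator (fun _ => ENNReal.ofReal (Real.exp (c₀ / 2 * (k + 1)))) y
    with hG
  have hpt : ∀ y : V, ENNReal.ofReal (Real.exp (c₀ / 2 * ‖y‖)) ≤ ∑' k, G k y := by
    intro y
    set k : ℕ := ⌊‖y‖⌋₊ with hk
    have hk1 : (k : ℝ) ≤ ‖y‖ := Nat.floor_le (norm_nonneg y)
    have hk2 : ‖y‖ < k + 1 := Nat.lt_floor_add_one ‖y‖
    refine le_trans ?_ (ENNReal.le_tsum k)
    rw [hG]; dsimp only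
    rw [indicator_of_mem (show y ∈ {y : V | (k : ℝ) ≤ ‖y‖} from hk1)]
    exact ENNReal.ofReal_le_ofReal (Real.exp_le_exp.2 (by nlinarith))
  have hGm : ∀ k, Measurable (G k) := fun k => (measurable_const.indicator (hSk k))
  -- integrate
  calc ∫⁻ y, ENNReal.ofReal (Real.exp (c₀ / 2 * ‖y‖)) ∂μ ≤ ∫⁻ y, ∑' k, G k y ∂μ := lintegral_mono hpt
    _ = ∑' k, ∫⁻ y, G k y ∂μ := lintegral_tsum fun k => (hGm k).aemeasurable
    _ = ∑' k : ℕ, ENNReal.ofReal (Real.exp (c₀ / 2 * ((k : ℝ) + 1))) * μ {y : V | (k : ℝ) ≤ ‖y‖} := by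
        refine tsum_congr fun k => ?_
        rw [hG]; dsimp only
        rw [lintegral_indicator_const (hSk k)]
    _ ≤ ∑' k : ℕ, ENNReal.ofReal (Real.exp (c₀ / 2) * D' * r ^ k) := by
        refine ENNReal.tsum_le_tsum fun k => ?_
        calc ENNReal.ofReal (Real.exp (c₀ / 2 * ((k : ℝ) + 1))) * μ {y : V | (k : ℝ) ≤ ‖y‖}
            ≤ ENNReal.ofReal (Real.exp (c₀ / 2 * ((k : ℝ) + 1))) *
                ENNReal.ofReal (D' * Real.exp (-(c₀ * k))) := mul_le_mul_right (hmass k) _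
          _ = ENNReal.ofReal (Real.exp (c₀ / 2) * D' * r ^ k) := by
              rw [← ENNReal.ofReal_mul (Real.exp_pos _).le]
              congr 1
              have e1 : r ^ k = Real.exp (-(c₀ / 2) * k) := by
                rw [hr, ← Real.exp_nat_mul]; congr 1; ring
              have e2 : Real.exp (c₀ / 2 * ((k : ℝ) + 1)) * Real.exp (-(c₀ * k)) =
                  Real.exp (c₀ / 2) * Real.exp (-(c₀ / 2) * k) := by
                rw [← Real.exp_add, ← Real.exp_add]; congr 1; ring
              rw [e1]
              calc Real.exp (c₀ / 2 * ((k : ℝ) + 1)) * (D' * Real.exp (-(c₀ * k)))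
                  = D' * (Real.exp (c₀ / 2 * ((k : ℝ) + 1)) * Real.exp (-(c₀ * k))) := by ring
                _ = D' * (Real.exp (c₀ / 2) * Real.exp (-(c₀ / 2) * k)) := by rw [e2]
                _ = Real.exp (c₀ / 2) * D' * Real.exp (-(c₀ / 2) * k) := by ring
    _ = ENNReal.ofReal (∑' k : ℕ, Real.exp (c₀ / 2) * D' * r ^ k) := by
        rw [← ENNReal.ofReal_tsum_of_nonneg (fun k => by positivity)
          ((summable_geometric_of_lt_one hr0.le hr1).mul_left _)]
    _ = _ := by
        rw [tsum_mul_left, tsum_geometric_of_lt_one hr0.le hr1]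
        congr 1

/-! ## The tails of `ν_β` are the route's tail sums -/

/-- Comparison of two cut-off lattice sums. -/
theorem tsum_ite_le_tsum_ite {p q : Site 3 → Prop} [DecidablePred p] [DecidablePred q]
    {f g : Site 3 → ℝ} (hpq : ∀ x, p x → q x) (hf : ∀ x, 0 ≤ f x) (hfg : ∀ x, p x → f x ≤ g x)
    (hg : ∀ x, 0 ≤ g x) (hs : Summable fun x => if q x then g x else 0) :
    (∑' x, if p x then f x else 0) ≤ ∑' x, if q x then g x else 0 := by
  have hle : ∀ x, (if p x then f x else 0) ≤ if q x then g x else 0 := fun x => by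
    by_cases hp : p x
    · rw [if_pos hp, if_pos (hpq x hp)]; exact hfg x hp
    · rw [if_neg hp]; split_ifs; exacts [hg x, le_refl _]
  have hnn : ∀ x, 0 ≤ (if p x then f x else 0) := fun x => by split_ifs; exacts [hf x, le_refl _]
  exact (hs.of_nonneg_of_le hnn hle).tsum_le_tsum hle hs

/-- A cut-off of `G_β` is summable below `β_c`. -/
theorem summable_ite_G {β : ℝ} (hβ : 0 ≤ β) (hβc : β < criticalBeta 3) (p : Site 3 → Prop)
    [DecidablePred p] : Summable fun x : Site 3 => if p x then twoPointFree 3 β x else 0 :=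
  (IsingInputs.summable_G hβ hβc).of_nonneg_of_le
    (fun x => by split_ifs; exacts [IsingInputs.G_nonneg hβ x, le_refl _])
    fun x => by split_ifs; exacts [le_refl _, IsingInputs.G_nonneg hβ x]

/-- **`ν_β` of a set as a real cut-off lattice sum**: `ν_β(B) = χ⁻¹ ∑_{x : x/ξ₂ ∈ B} G_β(x)`. -/
theorem nu_apply_toReal {β : ℝ} (hβ : 0 ≤ β) (hβc : β < criticalBeta 3) (B : Set V)
    [DecidablePred (· ∈ B)] :
    nu β B = ENNReal.ofReal ((chi β)⁻¹ *
      ∑' x : Site 3, if (xi β)⁻¹ • siteV x ∈ B then twoPointFree 3 β x else 0) := by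
  have hχ := chi_pos hβ hβc
  rw [nu, latMeasure_apply]
  have h1 : ∀ x : Site 3, (if (xi β)⁻¹ • siteV x ∈ B then
      ENNReal.ofReal (twoPointFree 3 β x / chi β) else 0) =
      ENNReal.ofReal (if (xi β)⁻¹ • siteV x ∈ B then twoPointFree 3 β x / chi β else 0) := by
    intro x; split_ifs <;> simp
  simp_rw [h1]
  rw [← ENNReal.ofReal_tsum_of_nonneg]
  · congr 1
    rw [← tsum_mul_left]
    refine tsum_congr fun x => ?_
    split_ifs <;> simp [div_eq_inv_mul]
  · intro x; split_ifs; exacts [div_nonneg (IsingInputs.G_nonneg hβ x) hχ.le, le_refl _]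
  · exact ((summable_ite_G hβ hβc (fun x => (xi β)⁻¹ • siteV x ∈ B)).div_const (chi β)).congr
      fun x => by split_ifs <;> simp

/-- The Euclidean tail condition `A < ‖x/ξ₂‖` is the route's `A² M₂ < |x|² χ`. -/
theorem lt_norm_smul_siteV_iff {β : ℝ} (hβ : 0 < β) (hβc : β < criticalBeta 3) {A : ℝ}
    (hA : 0 ≤ A) (x : Site 3) :
    A < ‖(xi β)⁻¹ • siteV x‖ ↔ A ^ 2 * msq β < (∑ i, ((x i : ℤ) : ℝ) ^ 2) * chi β := by
  have hξ := xi_pos hβ hβc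
  have hχ := chi_pos hβ.le hβc
  rw [norm_smul, Real.norm_eq_abs, abs_of_pos (inv_pos.2 hξ), ← norm_siteV_sq, ← div_eq_inv_mul,
    lt_div_iff₀ hξ]
  rw [show A ^ 2 * msq β = (A * xi β) ^ 2 * chi β by
    rw [mul_pow, xi_sq hβ.le hβc]; field_simp]
  rw [mul_lt_mul_iff_of_pos_right hχ]
  exact (pow_lt_pow_iff_left₀ (by positivity) (norm_nonneg _) two_ne_zero).symm

/-- **The tails of `ν_β`**: `ν_β{‖y‖ > A} = χ⁻¹ ∑_{x : A²M₂ < |x|²χ} G_β(x)` (`A ≥ 0`). -/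
theorem nu_tail_eq {β : ℝ} (hβ : 0 < β) (hβc : β < criticalBeta 3) {A : ℝ} (hA : 0 ≤ A) :
    nu β {y | A < ‖y‖} = ENNReal.ofReal ((chi β)⁻¹ * ∑' x : Site 3,
      if A ^ 2 * msq β < (∑ i, ((x i : ℤ) : ℝ) ^ 2) * chi β then twoPointFree 3 β x else 0) := by
  classical
  rw [nu_apply_toReal hβ.le hβc]
  congr 2
  refine tsum_congr fun x => ?_
  simp only [mem_setOf_eq, lt_norm_smul_siteV_iff hβ hβc hA x]

/-- **Uniform exponential moment of `ν_β` from the one-length window (CLW (ii)).** If for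
`β ∈ [β₀, β_c)` and all `A ≥ 1`, `∑_{x : A²M₂ < |x|²χ} G_β(x) ≤ C e^{-c₀A} χ(β)` (`c₀ > 0`), then
`∫ e^{(c₀/2)‖y‖} dν_β ≤ K` for one `K` and all `β ∈ [β₀, β_c) ∩ (0, β_c)`. -/
theorem nu_exp_moment {c₀ C β₀ : ℝ} (hc₀ : 0 < c₀)
    (hii : ∀ β : ℝ, β₀ ≤ β → β < criticalBeta 3 → ∀ A : ℝ, 1 ≤ A →
      (∑' x : Site 3, if A ^ 2 * msq β < (∑ i, ((x i : ℤ) : ℝ) ^ 2) * chi β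
        then twoPointFree 3 β x else 0) ≤ C * Real.exp (-(c₀ * A)) * chi β) :
    ∃ K : ℝ, ∀ β : ℝ, β₀ ≤ β → 0 < β → β < criticalBeta 3 →
      Integrable (fun y : V => Real.exp (c₀ / 2 * ‖y‖)) (nu β) ∧
        ∫ y, Real.exp (c₀ / 2 * ‖y‖) ∂(nu β) ≤ K := by
  set D : ℝ := max C 1 * Real.exp c₀ with hD
  have hD0 : 0 ≤ D := by positivity
  set K : ℝ := Real.exp (c₀ / 2) * (D * Real.exp (c₀ / 2) + 1) / (1 - Real.exp (-(c₀ / 2))) with hK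
  have hden : 0 < 1 - Real.exp (-(c₀ / 2)) := by
    have : Real.exp (-(c₀ / 2)) < 1 := Real.exp_lt_one_iff.2 (by linarith); linarith
  have hK0 : 0 ≤ K := by positivity
  refine ⟨K, fun β hβ₀ hβ hβc => ?_⟩
  haveI := isProbabilityMeasure_nu hβ.le hβc
  have hχ := chi_pos hβ.le hβc
  -- tail bound for all `A ≥ 0`
  have htail : ∀ A : ℝ, 0 ≤ A → nu β {y | A < ‖y‖} ≤ ENNReal.ofReal (D * Real.exp (-(c₀ * A))) := by
    intro A hA
    rcases le_or_gt 1 A with hA1 | hA1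
    · rw [nu_tail_eq hβ hβc hA]
      refine ENNReal.ofReal_le_ofReal ?_
      have h := hii β hβ₀ hβc A hA1
      calc (chi β)⁻¹ * _ ≤ (chi β)⁻¹ * (C * Real.exp (-(c₀ * A)) * chi β) :=
            mul_le_mul_of_nonneg_left h (inv_nonneg.2 hχ.le)
        _ = C * Real.exp (-(c₀ * A)) := by field_simp
        _ ≤ D * Real.exp (-(c₀ * A)) := by
            refine mul_le_mul_of_nonneg_right ?_ (Real.exp_pos _).le
            calc C ≤ max C 1 := le_max_left _ _
              _ = max C 1 * 1 := (mul_one _).symm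
              _ ≤ max C 1 * Real.exp c₀ := mul_le_mul_of_nonneg_left
                  (Real.one_le_exp (by linarith)) (le_trans zero_le_one (le_max_right _ _))
    · calc nu β {y | A < ‖y‖} ≤ 1 := prob_le_one
        _ ≤ ENNReal.ofReal (D * Real.exp (-(c₀ * A))) := by
            rw [← ENNReal.ofReal_one]
            refine ENNReal.ofReal_le_ofReal ?_
            have h1 : 1 ≤ Real.exp c₀ * Real.exp (-(c₀ * A)) := by
              rw [← Real.exp_add]; exact Real.one_le_exp (by nlinarith)
            calc (1 : ℝ) ≤ Real.exp c₀ * Real.exp (-(c₀ * A)) := h1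
              _ ≤ max C 1 * Real.exp c₀ * Real.exp (-(c₀ * A)) := by
                  rw [mul_assoc]
                  exact le_mul_of_one_le_left (by positivity) (le_max_right _ _)
  have hlint := lintegral_exp_le_of_tail (μ := nu β) prob_le_one hc₀ hD0 htail
  have hmeas : Measurable fun y : V => Real.exp (c₀ / 2 * ‖y‖) := by fun_prop
  have hint : Integrable (fun y : V => Real.exp (c₀ / 2 * ‖y‖)) (nu β) := by
    refine ⟨hmeas.aestronglyMeasurable, ?_⟩
    rw [hasFiniteIntegral_iff_norm]
    calc ∫⁻ y, ENNReal.ofReal ‖Real.exp (c₀ / 2 * ‖y‖)‖ ∂(nu β)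
        = ∫⁻ y, ENNReal.ofReal (Real.exp (c₀ / 2 * ‖y‖)) ∂(nu β) := by
          refine lintegral_congr fun y => ?_
          rw [Real.norm_eq_abs, abs_of_pos (Real.exp_pos _)]
      _ ≤ ENNReal.ofReal K := hlint
      _ < ⊤ := ENNReal.ofReal_lt_top
  refine ⟨hint, ?_⟩
  rw [integral_eq_lintegral_of_nonneg_ae (ae_of_all _ fun y => (Real.exp_pos _).le)
    hmeas.aestronglyMeasurable]
  exact ENNReal.toReal_le_of_le_ofReal hK0 hlint

end Summit.CriticalPhenomena.Ising3DConformalLimit.Theorems.HarmonicMomentsIsotropy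

end
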